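import Mathlib
import HarnessLib
import HarnessLib.Audit
import Summits.Ventures.CertifiedManyBodySolver.Observables.RungLeavesCoverageNdNiO2Cut

/-!
Route: CovNdNiO2M22

# Route CovNdNiO2M22 — hubbard-cov-ndnio2-2 — certified T = 0 flux-stiffness ceiling below 0.98 ×
kinematic on the Nd₀.₈Sr₀.₂NiO₂ film box M22, owed on the residual filling-padding cell, from two
apex-station U-slabs

It suffices to show X = ResidualLowUSlab22 ∧ ResidualHighUSlab22: on the RESIDUAL CELL t′/t ∈
[−23/50, −11/25] × U/t ∈ [5, 17/2] ×
n ∈ [393/500, 409/500] of the downfolded one-band box of the superconducting infinite-layer film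
Nd₀.₈Sr₀.₂NiO₂ (VSET M22, object E,
`boxNdSrNiO2E_M22` = U/t ∈ [5, 17/2] × t′/t ∈ [−23/50, −9/25] × n ∈ [359/500, 409/500]; T_c 9–15 K
is a float LABEL only) the
thermodynamic-limit uniform-flux stiffness admits the certified CEILING c = 0.4418857 (= 0.98 × the
box kinematic word κ₂₂ = 0.4509038,
`Downfold/BoxesNdNiO2EStiffnessKinematic.lean`, rounded down at the 7th decimal), split into the
LOW-U slab U/t ∈ [5, 110/21] (contains the
binding corner (5, −23/50, 409/500)) and the HIGH-U slab U/t ∈ [110/21, 17/2]. The rest of the box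
is node-free kinematics already below the bar
and PROVED in the tree (`Certificates.ndM22CutBoxE_stiffnessSeqLeaf` 0.4389096 on t′ ≥ −11/25,
`Certificates.ndBoxE_sr025_stiffnessSeqLeaf`
0.4414575 on n ≤ 393/500, glued by `NdNiO2M22_StiffnessBoxCeiling_of_cornerCellLeaf`); the
determination hull (n ∈ [96/125, 391/500]) is
closed node-free (`stiffnessBoxCeilingBelow_boxNdSrNiO2E_M22det_kinematic`, p643354) and disjoint
from the residual cell
(`Downfold.ndSrNiO2E_M22_res_disjoint_det`): the route's ENTIRE content is the +1/20 filling PADDING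
band above the hull, said plainly. The pair
is the registered rung leaf «MOS2-ndnio2-M22»; director ORDER (A) M22-LITE-3 (REQUESTS
2026-08-28T19:49:21Z) calls it as the like-for-like
replay of the CovNdNiO2M21 chain (scoreboard (3) SPEED datum).
Lean: `Summit.Ventures.CertifiedManyBodySolver.Theses.CovNdNiO2M22.ResidualLowUSlab22 ∧
Summit.Ventures.CertifiedManyBodySolver.Theses.CovNdNiO2M22.ResidualHighUSlab22`

## Assembly
Pure logic plus the tree's corner-cell discharger: `le_total U (110/21)` splits the residual cell's
U-interval [5, 17/2] into the two slabs, giving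
the cell leaf `∀ tp U n ∈ residual cell, ObsStiffnessSeqCeilingAt tp U n c` with c = 4418857/10⁷ ≤
bar (`le_rfl`), and
`NdNiO2M22_StiffnessBoxCeiling_of_cornerCellLeaf` (box-2,
`Observables/RungLeavesCoverageNdNiO2Cut.lean`: the t′ ≥ −11/25 cut leaf 0.4389096
and the n ≤ 393/500 leaf 0.4414575, both node-free kernel theorems below the bar) concludes the
registered leaf. The deciding theorem is `closes`
in glue.lean (elaborates: SketchM22.lean `lean check` rc 0, 0 sorry, 2026-08-28 19:5xZ, captain g3).

CLOSES_TARGET: closes rung MO-S2 of Ventures/CertifiedManyBodySolver: Summit.Ventures.CertifiedManyBodySolver.Observables.NdNiO2M22_StiffnessBoxCeiling (D-0061; not the summit Statement) — the deciding theorem of this route concludes that registered leaf (Ventures/CertifiedManyBodySolver: no summit Statement) (class rung: servable and labelled, never counted as concluding the summit Statement).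

Rationale: WHY THIS LINE. The mechanism is the f-sum (odd-moment) CEILING on the flux stiffness
(ScalapinoWhiteZhang1993 §II; HazraVermaRanderia2019 eqs. (2)–(6);
ParamekantiTrivediRanderia1998): ρ_s ≤ ⟨X₀(t′, U)⟩, whose thermodynamic-limit ground-state
expectation is bounded by a certified moment/RDM
window at ONE station (s, U_A = 5, n) and transported over a (t′, U) rectangle and a density
interval by the apex-station theorems in tree
(`ObsStiffnessSeqCeilingAt_on_box_of_apexStation_twoEndObjectives` / `…_on_highSlab_…`:
U-monotonicity along the Hellmann–Feynman orbit
plus the σ-chord of two END objectives −X₀(−23/50, 5), −X₀(−11/25, 5); no K₂ input), with the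
density direction read by density-affine
bundle rows (`TPrimeBundleOrbitLowerRowWN`, kernel law `TPrimePinnedPairRowWN.bundleWN` p662147) and
node-free window keys
(`ndBoxE_station5_afChordCap_segA_m22_q` / `_segBC_m22_q` p662195; band-bottom floors). Imported
from many-body sum-rule theory and convex
optimisation (exact rational SDP duals, arXiv:2310.05844); nothing probabilistic. What it does that
CovNdNiO2M21 does not: the same
instrument one VSET column over (Sr-doped SC film, n ≈ 0.82 instead of 0.95) where the one-body
majorant misses the bar by 0.66 % at the
corner and the residual is pure filling padding — a measured REPLAY of a closed chain at a second
material point, bought for its meter.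

RANKED CRUXES. #2 ResidualLowUSlab22 (crux) — on the low-U slab U/t ∈ [5, 110/21] of the M22
residual cell, for every t′/t ∈ [−23/50, −11/25] and n ∈ [393/500, 409/500], the uniform-flux
stiffness ceiling `ObsStiffnessSeqCeilingAt tp U n (4418857/10⁷)` holds (intended witness: ONE
station at U_A = 5, two END objectives −X₀(−23/50, 5) (TWO density-affine bundle rows on s-segments
B [−11/20, −23/50] / C [−23/50, −11/25] from hub ⊕ pinned-spoke SDP certificates at (5, 409/500))
and −X₀(−11/25, 5) (a THEOREM: p636407's kinematic line, 0.4418570 ≤ bar), slots σ ∈ [−23/50,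
−11/25], sources s ∈ [23σ/22, σ] ⊂ B ∪ C; the cut U₁ = 110/21 is the EXACT threshold (−11/25)(2 −
5/U₁) = −23/50 (unc-3 g5, obs STATUS 2026-08-28T23:17:42Z): below it the shallowest slot's source
enters segment C; BC3 skeleton `bc/ResidualLowUSlab22_birth.lean`). [difficulty: L] (why it might
fail: WINDOW-LIMITED at the top filling edge n = 409/500: the far-segment hub word must land ≤
0.4419 while its free value is 0.4131 (room 6.98 %, forecast word ≈ 0.428 [float]); the only energy
caps are Hartree–Fock-class chords (EnergyWindowCeilingResolution).) [HazraVermaRanderia2019,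
ScalapinoWhiteZhang1993, arXiv:2310.05844, KomaTasaki1994]
#3 ResidualHighUSlab22 (crux) — the same ceiling on the high-U slab U/t ∈ [110/21, 17/2] of the M22
residual cell (intended witness: the U_A = 5 station's overhang to the far source (−23/50)(24/17) =
−276/425 — segment A's hub — via
`ObsStiffnessSeqCeilingAt_on_highSlab_of_apexStation_twoEndObjectives`, TWO bundle rows A [−276/425,
−11/20] / B [−11/20, −23/50] (B on its full segment), i.e. 93.2 % of the residual cell's U-range
closes modulo two P nodes; BC3 skeleton `bc/ResidualHighUSlab22_birth.lean`). [difficulty: M] (why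
it might fail: the high-U slab is reached only through the U-orbit from U_A = 5, so it needs the FAR
source s = −276/425 at n = 0.818 where the free value 0.4131 is 6.98 % under the bar and the M21
twin closed with margin 0.0038 only; a window slack above ≈ 0.013 kills it.)
[HazraVermaRanderia2019, arXiv:2310.05844, KomaTasaki1994, ParamekantiTrivediRanderia1998]

TWO-LAYER PLAN. Foreseen glued splits (nothing filed now): both slabs ⇐ the SAME station-5 bundle
rows — unc-3's funnel
`Observables/RungLeavesCoverageNdNiO2M22ResidualBundles.lean`
(`ndM22_residual_of_bundleRowsWN_capTables`: three P bundle rows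
`TPrimeBundleOrbitLowerRowWN 5 s₁ s₂ lo hi F sl₁ sl₂ (409/500) (fun _ => −X₀(−23/50, 5))` on A/B/C +
the Q/T rows as theorems
(`ndM22_QRowWN_kinematic`, from p636407) + the cap tables p662195 + the floor tables + end prices at
393/500 and 409/500 ≤ c ≤ 4418857/10⁷
⇒ the residual-cell statement ⇒ both slabs by restriction). The rows are the M22 twins of the
CovNdNiO2M21 rows of record (A e0 j314087,
B e1 j313367, C e1 j313498): three hubs at (5, 409/500), sources −276/425 / −11/20 / −23/50, three
spokes pinned to them at −11/20 / −23/50 /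
−11/25, three pinned-pair reads; each row enters as ONE `@[conjecture]` bundle (or pair) claim node
tied by a second exact reader.

KILL CRITERIA. ROUTE-KILL witness (as for CovNdNiO2M21, referee wording): a certified torus-limit
ground-state FLOOR on ⟨X₀(−23/50, 5)⟩ (or on the σ-chord of
the two END objectives) ABOVE 0.4418857 at a point of the residual cell — then no f-sum /
orbit-lower edition can close there and the line as
drawn is dead (close --reason refuted-line; the det-hull word p643354 stays booked as CONTROL). ITEM
REFUTATION as typed = a certified
flux-STIFFNESS floor above the bar — not producible by any instrument of record for the repulsive
model (StiffnessFloorInvisibleToSpectralMoments).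
The REALISTIC failure is INSTRUMENTAL: a hub word above 0.4418857 (captain kill K1: any hub word >
0.436 triggers a segment split / e1 edition
before its spoke; two hubs > 0.436 ⇒ stop and report), or the director's budget kill (chain spend >
300 reserved core-h, or a third re-key on a
segment) — then the leaf stays OPEN, the words are banked as CONTROL numbers and the partial replay
datum is reported.

NOT DECOMPOSED YET. The bundle rows (values F, slopes, windows), the pinned-pair reads and their
editions (e0 plain / e1 letters), the claim-node shape (bundle node
of the M21 kind or PAIR node + `…_wn_of_pair` via p662147), the GENONLY midpoint twins and the exact
rational certificate format are layer-2 /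
producer business (seats hubbard-cov-ndnio2-sdp-1/ -sdp-2/ -gen-1/ -box-1/ -box-2/ -unc-3, referee
-ref-1, captain -plan-1: NDNIO2-COVERAGE-PLAN
v1.0 §9); the slab split point U_s = 110/21 is a free parameter (re-split, not a new route); ONE
station closes both slabs by design.

CHEAPEST FALSIFIER. Done by the captain [float, not of record]: the free / one-body table of
NDNIO2-COVERAGE-PLAN v1.0 §9.1 — no END-objective source of the residual
cell has its FREE value above the bar (rooms +6.98 % at the far source (5, −276/425, 0.818), +12.40
% at −11/20, +15.52 % at the corner); the
binding one-body MAJORANT at the corner is 0.4448192 = bar + 0.66 %, so kinematics alone cannot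
close the cell (hence the SDP rows). The first
solver data are the three hub words (hubbard-cov-ndnio2-sdp-1 g2, PRE-REG obs STATUS l.3968: H1
[0.413, 0.436] / H2 [0.393, 0.415] /
H3 [0.382, 0.405]); PASS word iff c ≤ 0.4418857.

NUMBERS. Box kinematic word κ₂₂ = 0.4509038 (tree, `Downfold/BoxesNdNiO2EStiffnessKinematic.lean`);
bar 0.98 × ↦ 4418857/10⁷; cover constants 0.4389096
(t′ ≥ −11/25, `ndM22CutBoxE_stiffnessSeqLeaf`) and 0.4414575 (n ≤ 393/500,
`ndBoxE_sr025_stiffnessSeqLeaf`, margin 0.0004282); det hull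
n ∈ [96/125, 391/500] closed node-free (p643354); residual cell = t′ ∈ [−23/50, −11/25] × n ∈
[393/500, 409/500]; binding corner float kinematic
0.4448192 (+0.66 % over the bar), free value there 0.3825 (13.4 % under the bar); Q/T slot
−X₀(−11/25, 5) by theorem 0.4418570 (margin
0.0000288 exact); window keys: caps −8264354689/10¹⁰ (segA) / −7921515759/10¹⁰ (segBC) (p662195),
floors −112884/53125 ∣ −4499/2500 ∣
−5726/3125 (band-bottom minima at 409/500). Interim clause as for M21: content = below 0.98 × the
kinematic MAJORANT word; no
suppression-below-free is claimed. Parent twin CovNdNiO2M21 (bar 4779578/10⁷): both cruxes closed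
modulo three bundle nodes 2026-08-28.

DEFINITION REQUESTS. None: every notion is in tree (`ObsStiffnessSeqCeilingAt`,
`StiffnessBoxCeilingBelow`, `boxNdSrNiO2E_M22`, the apex-station, residual-cover
and bundle-row theorems, the t′-pair law p662147).

Novelty: Searches (2026-08-28, inherited from CovNdNiO2M21's filing + the captain's plan): `lit search
--hybrid "upper bound superfluid stiffness kinetic energy f-sum rule Hubbard model" -n 6`
([corpus:book:lipparini2008 pp. 464–465], [corpus:book:griffin1995 p. 470], [corpus:book:lieb2005 p.
169]); `lit galaxy search "superfluid stiffness|f-sum rule|nickelate" --star all` (hits are float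
numerics / reviews, no certified bound); `lean search StiffnessBoxCeilingBelow` (tree only).
Nearest prior art found: HazraVermaRanderia2019 (PRX 9, 031049: D_s ≤ kinetic bound, float
numerics); the programme's own route CovNdNiO2M21 (same instrument, VSET M21) and the La214 /
Hg-1201 coverage routes.
Delta: none in mechanism — a like-for-like REPLAY of CovNdNiO2M21 at the Sr-doped film's box (second
VSET column), registered because the director bought the measured replay datum; a registration (crew
rung route), not a mechanism.
Claimed grade: known  [refs: book:lipparini2008, book:griffin1995, book:lieb2005, HazraVermaRanderia2019]

Barriers (technique_class: sdp-lower-bound, sum-rule-moment-ceiling, box-transport): - technique_class: sdp-lower-bound, sum-rule-moment-ceiling, box-transport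
- Literature.Barriers.HubbardSuperconductivity.StiffnessFloorInvisibleToSpectralMoments: conceded
and irrelevant — the route claims CEILINGS only, which is exactly what finitely many moments give;
it is also why an ITEM refutation (a stiffness floor) is not producible by the instruments of
record.
- Literature.Barriers.HubbardSuperconductivity.EnergyWindowCeilingResolution: inside its class and
load-bearing — the ceiling resolves only down to the window slack; the bet (numbers): M21's three
segment words cleared a bar with rooms +4.9/+6.1/+7.4 % by margins 0.0038/0.0181/0.0221 under
HF-class caps; M22's rooms are +7.0/+12.4/+15.5 % under caps 0.110/0.084 deeper.
- Literature.Barriers.HubbardSuperconductivity.DegreeFourSosMissesSecondOrderPerturbation: not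
biting — no suppression below the free value needs certifying anywhere on this box (bar sits 13.4 %
above free at the binding corner).
- Literature.Barriers.HubbardSuperconductivity.SignProblemNPHard: outside its class — exact rational
dual certificates, nothing sampled.
- Literature.Barriers.HubbardSuperconductivity.OrderParameterInvisibleToGroundStateConstraints:
conceded, irrelevant (no order-parameter floor claimed).
- Negatives index: `ledger negatives --problem Ventures` / `--problem HubbardSuperconductivity` — no
refuted statement concerns a stiffness ceiling on a t′ < 0 doped box; the refuted finite-field
RESPONSE floors (hubbard-obs AFBCS/PM

sub-problem: CertifiedManyBodySolver · status: draft · opened planner-hubbard-obs-lead-g27-0 2026-08-29T01:26:45Z · rev 0 · ledger route-Ventures-CovNdNiO2M22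
GENERATED by the gate from the ledger (D-0016/17). Provers cite these decls: `theorem foo : Summit.Ventures.CertifiedManyBodySolver.Theses.CovNdNiO2M22.<Decl> := …` in Summits/Ventures/CertifiedManyBodySolver/Theorems/<Name>.lean.
-/

namespace Summit.Ventures.CertifiedManyBodySolver.Theses.CovNdNiO2M22

open scoped BigOperators Topology Manifold Classical MeasureTheory ProbabilityTheory Matrix InnerProductSpace ComplexConjugate ContinuousMap
open Filter Set Function TopologicalSpace MeasureTheory

-- H21.Audit: Ventures rung route — no summit Statement decl; the expected conclusion is the closer leaf tagged below
attribute [summit_statement] _root_.Summit.Ventures.CertifiedManyBodySolver.Observables.NdNiO2M22_StiffnessBoxCeiling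

/-- item stmt-Ventures-23945 · crux · rank 2 · open · by planner
why it might fail: WINDOW-LIMITED at the top filling edge n = 409/500: the far-segment hub word must land ≤ 0.4419 while its free value is 0.4131 (room 6.98 %, forecast word ≈ 0.428 [float]); the only energy caps are Hartree–Fock-class chords (EnergyWindowCeilingResolution).
sources: HazraVermaRanderia2019, ScalapinoWhiteZhang1993, arXiv:2310.05844, KomaTasaki1994
[crux] on the low-U slab U/t ∈ [5, 110/21] of the M22 residual cell, for every t′/t ∈ [−23/50,
−11/25] and n ∈ [393/500, 409/500], the uniform-flux stiffness ceiling `ObsStiffnessSeqCeilingAt tp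
U n (4418857/10⁷)` holds (intended witness: ONE station at U_A = 5, two END objectives −X₀(−23/50,
5) (TWO density-affine bundle rows on s-segments B [−11/20, −23/50] / C [−23/50, −11/25] from hub ⊕
pinned-spoke SDP certificates at (5, 409/500)) and −X₀(−11/25, 5) (a THEOREM: p636407's kinematic
line, 0.4418570 ≤ bar), slots σ ∈ [−23/50, −11/25], sources s ∈ [23σ/22, σ] ⊂ B ∪ C; the cut U₁ =
110/21 is the EXACT threshold (−11/25)(2 − 5/U₁) = −23/50 (unc-3 g5, obs STATUS
2026-08-28T23:17:42Z): below it the shallowest slot's source enters segment C; BC3 skeleton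
`bc/ResidualLowUSlab22_birth.lean`). [difficulty: L] -/
@[route_item "route-Ventures-CovNdNiO2M22"]
def ResidualLowUSlab22 : Prop :=
  ∀ tp ∈ Set.Icc (-23 / 50 : ℝ) (-11 / 25), ∀ U ∈ Set.Icc (5 : ℝ) (110 / 21), ∀ n ∈ Set.Icc (393 / 500 : ℝ) (409 / 500), Summit.Ventures.CertifiedManyBodySolver.Observables.ObsStiffnessSeqCeilingAt tp U n (4418857 / 10000000)

/-- item stmt-Ventures-23946 · crux · rank 3 · open · by planner
why it might fail: the high-U slab is reached only through the U-orbit from U_A = 5, so it needs the FAR source s = −276/425 at n = 0.818 where the free value 0.4131 is 6.98 % under the bar and the M21 twin closed with margin 0.0038 only; a window slack above ≈ 0.013 kills it.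
sources: HazraVermaRanderia2019, arXiv:2310.05844, KomaTasaki1994, ParamekantiTrivediRanderia1998
[crux] the same ceiling on the high-U slab U/t ∈ [110/21, 17/2] of the M22 residual cell (intended
witness: the U_A = 5 station's overhang to the far source (−23/50)(24/17) = −276/425 — segment A's
hub — via `ObsStiffnessSeqCeilingAt_on_highSlab_of_apexStation_twoEndObjectives`, TWO bundle rows A
[−276/425, −11/20] / B [−11/20, −23/50] (B on its full segment), i.e. 93.2 % of the residual cell's
U-range closes modulo two P nodes; BC3 skeleton `bc/ResidualHighUSlab22_birth.lean`). [difficulty: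
M] -/
@[route_item "route-Ventures-CovNdNiO2M22"]
def ResidualHighUSlab22 : Prop :=
  ∀ tp ∈ Set.Icc (-23 / 50 : ℝ) (-11 / 25), ∀ U ∈ Set.Icc (110 / 21 : ℝ) (17 / 2), ∀ n ∈ Set.Icc (393 / 500 : ℝ) (409 / 500), Summit.Ventures.CertifiedManyBodySolver.Observables.ObsStiffnessSeqCeilingAt tp U n (4418857 / 10000000)

/-- item stmt-Ventures-23947 · assembly · rank 1 · closed · proved by Summit.Ventures.CertifiedManyBodySolver.Theorems.covNdNiO2M22Assembly_proof (prover) · by planner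
sources: ScalapinoWhiteZhang1993
[assembly] ResidualLowUSlab22 → ResidualHighUSlab22 → the rung leaf NdNiO2M22_StiffnessBoxCeiling -/
@[route_item "route-Ventures-CovNdNiO2M22"]
def Assembly : Prop :=
  Summit.Ventures.CertifiedManyBodySolver.Theses.CovNdNiO2M22.ResidualLowUSlab22 → Summit.Ventures.CertifiedManyBodySolver.Theses.CovNdNiO2M22.ResidualHighUSlab22 → Summit.Ventures.CertifiedManyBodySolver.Observables.NdNiO2M22_StiffnessBoxCeiling

-- `Assembly` holds: proved by `Summit.Ventures.CertifiedManyBodySolver.Theorems.covNdNiO2M22Assembly_proof` (its module imports this route file, so no `_holds` link can be stated here).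

/-! D-0027 §2.1 — DECIDING THEOREM (planner-authored via `route open/edit --closes-file`; by planner-hubbard-obs-lead-g27-0 2026-08-29T01:26:45Z):
its hypotheses are this route's items and its conclusion the registered leaf `Summit.Ventures.CertifiedManyBodySolver.Observables.NdNiO2M22_StiffnessBoxCeiling` (rung MO-S2, D-0061) (glue_lint), and it elaborates with this file. -/

@[closes "route-Ventures-CovNdNiO2M22"] theorem closes (h₁ : ResidualLowUSlab22) (h₂ : ResidualHighUSlab22) :
    Summit.Ventures.CertifiedManyBodySolver.Observables.NdNiO2M22_StiffnessBoxCeiling :=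
  Summit.Ventures.CertifiedManyBodySolver.Observables.NdNiO2M22_StiffnessBoxCeiling_of_cornerCellLeaf le_rfl
    fun tp htp U hU n hn => by
      rcases le_total U (110 / 21) with h | h
      · exact h₁ tp htp U ⟨hU.1, h⟩ n hn
      · exact h₂ tp htp U ⟨h, hU.2⟩ n hn

end Summit.Ventures.CertifiedManyBodySolver.Theses.CovNdNiO2M22
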